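/-
Copyright (c) 2026 the pub-hodgecm-mathlib formalisation cell (harness21).  Prover seat hodgecm-mathlib-K2E5-p04 (g3), HCML Track B «K2-LIT» (build stream 29),
h413 = `stmt-HodgeConjecture-24833`, line `K2_E3_EllipticInputs`, unit U12 «Characters», socket #11 road (11-SC), letter (SC-an), END-GAME MAP v5 (line lead
K2E3-p14 (g4) RULINGS #15 (R15-2) ∕ #16 (R16-2)): the ROAD-A PAYER of the letter-neutral docking (M5h‴) — «HC-14-ell at the place» ⇒ «ELL-WEIGHT at the place».  2026-09-04.
-/
import Summits.HodgeConjecture.HodgeConjecture.Theorems.K2E3SupercuspidalTruncatedCharWeightKit     -- ★ (M5h) FILE A p857048 (this seat): `locallyIntegrable_inv_token_mul_log_pow` (the token `T⁻¹(1+|log T|)^k ∈ L¹_loc`, HC-D-ε ★)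
import Literature.Algebra.Polynomial.DiscriminantSignRealRoots                                         -- ★ `discr_ne_zero_iff_separable` (Basu–Pollack–Roy Prop. 4.3)
import HarnessLib

/-!
# h413 ∕ Track B «K2-LIT», line `K2_E3_EllipticInputs`, unit U12, road (11-SC), letter (SC-an) — THE ROAD-A PAYER OF (M5h‴): HARISH-CHANDRA'S THEOREM 14 AT THE PLACE
# («HC-14-ell», hosted form `sig_K2E3HC14EllRankOnePlace`) GIVES THE ELLIPTIC ORBITAL WEIGHT «ELL-WEIGHT» WITH `W_E := C · T⁻¹`
# (Harish-Chandra 1970, Part VI §8 Theorem 14 p. 60; Part VII §1 Theorem 15 p. 63)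

Cell `pub/hodgecm-mathlib`, crux H413 = `stmt-HodgeConjecture-24833`, route of record `HCCMUnconditional`; dealer K2E3-plan (g3), (SC-an) line lead K2E3-p14 (g4) (RULINGS #15
(R15-2): «two payers: `ellWeightPlace_of_hc14EllPlace` (road A) … `ellWeightPlace_of_finConj` (road FC)»).  THEOREMS ONLY (no `def`, no `instance`, no `notation`, no `sorry`);
lane `--supports stmt-HodgeConjecture-24833 --as helper`, count-neutral.

For `U_w := U(σ_w, Φ₃)(L_w)` (`σ_w = galAdicCompletionMap c hw`), a Haar measure `μ` and a compact `S ⊆ U_w`: IF `∃ C, T(γ) · ∫⁻ x, Θ (x γ x⁻¹) ∂μ ≤ C · M` for all Borel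
`Θ ≤ M` vanishing off `S` and all regular `γ` with compact centraliser (`T(γ) = √√(|discr χ_γ|·|det γ|⁻²)`, Harish-Chandra's normalisation `|D|^{1∕2}`), THEN the weight
**`W_E(γ) := C · T(γ)⁻¹`** is `≥ 0`, locally integrable (★ FILE A `locallyIntegrable_inv_token_mul_log_pow` at exponent `0` — Harish-Chandra's Theorem 15 `|D|^{-1∕2-ε} ∈ L¹_loc`,
★ HC-D-ε), and `∫⁻ x, Θ (x γ x⁻¹) ∂μ ≤ W_E(γ) · M` (divide by `T(γ) ≠ 0`: `γ` regular ⇒ `χ_γ` separable ⇒ `discr χ_γ ≠ 0`).  §1 proves this AT ONE `(L, w, μ, S)`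
(`ellWeightPlace_of_hc14Ell_at`); §2 is the ∀-closed adapter **`ellWeightPlace_of_hc14EllPlace (hEll : ‹cand v2 ∀-closed, ★ p857125's binder›) : ‹«ELL-WEIGHT at the place»
∀-closed, ★ (M5h‴)'s binder›`**, so that the road-A tie is `sigSCan_datum_of_ellWeightPlace L H (ellWeightPlace_of_hc14EllPlace sig_K2E3HC14EllRankOnePlace) hH hdet v hns μ r hsc B hBinv v₁`.

HONEST LABEL.  HC_CM is proved only modulo the 7 printed citations (2 remaining named inputs: hLiu418 = `stmt-HodgeConjecture-24832`, h413 = `stmt-HodgeConjecture-24833`)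
until rung 0 closes; count-neutral helper; «HC-14-ell» is NOT proved here (road A E1–E5 ∕ road FC in flight); (SC-an) is ★ only modulo «ELL-WEIGHT at the place».

## References
* [HarishChandra1970] Harish-Chandra (notes by G. van Dijk), *Harmonic Analysis on Reductive p-adic Groups*, LNM 162 (1970), Part VI §8 Theorem 14 p. 60; Part VII §1
  Theorem 15 p. 63.
* [Rogawski1990] J. D. Rogawski, *Automorphic Representations of Unitary Groups in Three Variables*, Ann. of Math. Stud. 123 (1990), §7.3 p. 97, §12.5 p. 182.
* [BasuPollackRoy2006] S. Basu, R. Pollack, M.-F. Roy, *Algorithms in Real Algebraic Geometry*, 2nd ed. (2006), Prop. 4.3.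
-/

set_option autoImplicit false
-- the mandated namespace repeats the single-problem summit's segment (`HodgeConjecture.HodgeConjecture`)
set_option linter.dupNamespace false

noncomputable section

open MeasureTheory Measure Set Filter Topology NumberField IsDedekindDomain
open scoped NNReal ENNReal Pointwise Matrix MatrixGroups WithZero
open ValuativeRel
open Literature.NumberTheory.Automorphic Literature.NumberTheory.Automorphic.UnitaryGroup Literature.NumberTheory.Rogawski1990
open Literature.NumberTheory.GaloisRepresentations Literature.NumberTheory.GaloisRepresentations.IsNonarchimedeanLocalField

namespace Summit.HodgeConjecture.HodgeConjecture.Cruxes.H413.K2E3EllWeightPlaceOfHC14EllPlace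

/-! ## §1 At one place datum `(L, w, μ, S)`: `W_E := C · T⁻¹` -/
set_option maxHeartbeats 800000 in -- long statement on the one-place carrier
/-- **«HC-14-ell» AT `(L, w, μ, S)` ⇒ «ELL-WEIGHT» AT `(L, w, μ, S)`** with `W_E(γ) := C · T(γ)⁻¹` (written `C · (T⁻¹ · (1 + |log T|)^0)`): nonnegative, locally integrable by
★ FILE A `locallyIntegrable_inv_token_mul_log_pow` (exponent `0`; Harish-Chandra's Theorem 15), and dominating `∫⁻ x, Θ (x γ x⁻¹) ∂μ` by `W_E(γ) · M` at every regular `γ` with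
compact centraliser (`T(γ) ≠ 0` since `χ_γ` is separable). [cite: HarishChandra1970, Part VI §8 Theorem 14 p. 60; Part VII §1 Theorem 15 p. 63] [cite: Rogawski1990, §7.3 p. 97, §12.5 p. 182] -/
theorem ellWeightPlace_of_hc14Ell_at (L : Type) [Field L] [NumberField L] [IsCMField L] {v : HeightOneSpectrum (𝓞 ↥(maximalRealSubfield L))}
    (w : UnitaryGroup.PlacesOver L v) (hw : IsCMField.complexConj L • w.1 = w.1)
    [MeasurableSpace ↥(unitaryGroupOfForm (galAdicCompletionMap (L := L) (IsCMField.complexConj L) hw) ((StdForm.antidiagonal 3).over (w.1.adicCompletion L)))]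
    [BorelSpace ↥(unitaryGroupOfForm (galAdicCompletionMap (L := L) (IsCMField.complexConj L) hw) ((StdForm.antidiagonal 3).over (w.1.adicCompletion L)))]
    (μ : Measure ↥(unitaryGroupOfForm (galAdicCompletionMap (L := L) (IsCMField.complexConj L) hw) ((StdForm.antidiagonal 3).over (w.1.adicCompletion L)))) [μ.IsHaarMeasure]
    {S : Set ↥(unitaryGroupOfForm (galAdicCompletionMap (L := L) (IsCMField.complexConj L) hw) ((StdForm.antidiagonal 3).over (w.1.adicCompletion L)))}
    (hC : ∃ C : ℝ≥0, ∀ Θ : ↥(unitaryGroupOfForm (galAdicCompletionMap (L := L) (IsCMField.complexConj L) hw) ((StdForm.antidiagonal 3).over (w.1.adicCompletion L))) → ℝ≥0∞,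
      Measurable Θ → (∀ g, Θ g ≠ 0 → g ∈ S) → ∀ M : ℝ≥0∞, (∀ g, Θ g ≤ M) →
      ∀ γ : ↥(unitaryGroupOfForm (galAdicCompletionMap (L := L) (IsCMField.complexConj L) hw) ((StdForm.antidiagonal 3).over (w.1.adicCompletion L))),
        IsRegularElt (γ : GL (Fin 3) (w.1.adicCompletion L)) →
        IsCompact ((Subgroup.centralizer ({γ} : Set ↥(unitaryGroupOfForm (galAdicCompletionMap (L := L) (IsCMField.complexConj L) hw) ((StdForm.antidiagonal 3).over (w.1.adicCompletion L))))) :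
            Set ↥(unitaryGroupOfForm (galAdicCompletionMap (L := L) (IsCMField.complexConj L) hw) ((StdForm.antidiagonal 3).over (w.1.adicCompletion L)))) →
          ((NNReal.sqrt (NNReal.sqrt
              (normAbs (w.1.adicCompletion L) (((γ : GL (Fin 3) (w.1.adicCompletion L)) : Matrix (Fin 3) (Fin 3) (w.1.adicCompletion L))).charpoly.discr *
                (normAbs (w.1.adicCompletion L) (((γ : GL (Fin 3) (w.1.adicCompletion L)) : Matrix (Fin 3) (Fin 3) (w.1.adicCompletion L))).det ^ 2)⁻¹)) :
              ℝ≥0) : ℝ≥0∞) *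
            ∫⁻ x, Θ (x * γ * x⁻¹) ∂μ ≤ C * M) :
    ∃ W_E : ↥(unitaryGroupOfForm (galAdicCompletionMap (L := L) (IsCMField.complexConj L) hw) ((StdForm.antidiagonal 3).over (w.1.adicCompletion L))) → ℝ,
      LocallyIntegrable W_E μ ∧ (∀ g, 0 ≤ W_E g) ∧
      ∀ γ : ↥(unitaryGroupOfForm (galAdicCompletionMap (L := L) (IsCMField.complexConj L) hw) ((StdForm.antidiagonal 3).over (w.1.adicCompletion L))),
        IsRegularElt (γ : GL (Fin 3) (w.1.adicCompletion L)) →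
        IsCompact ((Subgroup.centralizer ({γ} : Set ↥(unitaryGroupOfForm (galAdicCompletionMap (L := L) (IsCMField.complexConj L) hw) ((StdForm.antidiagonal 3).over (w.1.adicCompletion L))))) :
            Set ↥(unitaryGroupOfForm (galAdicCompletionMap (L := L) (IsCMField.complexConj L) hw) ((StdForm.antidiagonal 3).over (w.1.adicCompletion L)))) →
          ∀ Θ : ↥(unitaryGroupOfForm (galAdicCompletionMap (L := L) (IsCMField.complexConj L) hw) ((StdForm.antidiagonal 3).over (w.1.adicCompletion L))) → ℝ≥0∞,
            Measurable Θ → (∀ g, Θ g ≠ 0 → g ∈ S) → ∀ Mb : ℝ≥0∞, (∀ g, Θ g ≤ Mb) →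
              ∫⁻ x, Θ (x * γ * x⁻¹) ∂μ ≤ ENNReal.ofReal (W_E γ) * Mb := by
  obtain ⟨C, hC⟩ := hC
  -- the token as an opaque function, its positivity at regular elements
  obtain ⟨T, hT⟩ : ∃ T : ↥(unitaryGroupOfForm (galAdicCompletionMap (L := L) (IsCMField.complexConj L) hw) ((StdForm.antidiagonal 3).over (w.1.adicCompletion L))) → ℝ≥0,
      ∀ m, T m = (NNReal.sqrt (NNReal.sqrt
        (normAbs (w.1.adicCompletion L) (((m : GL (Fin 3) (w.1.adicCompletion L)) : Matrix (Fin 3) (Fin 3) (w.1.adicCompletion L))).charpoly.discr *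
          (normAbs (w.1.adicCompletion L) (((m : GL (Fin 3) (w.1.adicCompletion L)) : Matrix (Fin 3) (Fin 3) (w.1.adicCompletion L))).det ^ 2)⁻¹))) := ⟨_, fun _ => rfl⟩
  have hT0 : ∀ m : ↥(unitaryGroupOfForm (galAdicCompletionMap (L := L) (IsCMField.complexConj L) hw) ((StdForm.antidiagonal 3).over (w.1.adicCompletion L))),
      IsRegularElt (m : GL (Fin 3) (w.1.adicCompletion L)) → T m ≠ 0 := fun m hreg => by
    have hdisc : (((m : GL (Fin 3) (w.1.adicCompletion L)) : Matrix (Fin 3) (Fin 3) (w.1.adicCompletion L))).charpoly.discr ≠ 0 :=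
      (Literature.Algebra.Polynomial.DiscriminantSignRealRoots.discr_ne_zero_iff_separable
        (by rw [Matrix.charpoly_degree_eq_dim, Fintype.card_fin]; exact_mod_cast (by norm_num : (0 : ℕ) < 3))).2 hreg
    have hdet' : (((m : GL (Fin 3) (w.1.adicCompletion L)) : Matrix (Fin 3) (Fin 3) (w.1.adicCompletion L))).det ≠ 0 := by
      have h := (Matrix.GeneralLinearGroup.det (m : GL (Fin 3) (w.1.adicCompletion L))).ne_zero
      rwa [Matrix.GeneralLinearGroup.val_det_apply] at h
    rw [hT]
    intro h
    have h' := NNReal.sqrt_eq_zero.1 (NNReal.sqrt_eq_zero.1 h)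
    exact mul_ne_zero ((map_ne_zero _).2 hdisc) (inv_ne_zero (pow_ne_zero 2 ((map_ne_zero _).2 hdet'))) h'
  -- `T⁻¹ ∈ L¹_loc` (★ FILE A, exponent 0)
  have hf := K2E3SupercuspidalTruncatedCharWeightKit.locallyIntegrable_inv_token_mul_log_pow L w hw (J := (StdForm.antidiagonal 3).over (w.1.adicCompletion L)) rfl μ 0
  simp only [← hT] at hf
  refine ⟨fun γ => (C : ℝ) * (((T γ : ℝ))⁻¹ * (1 + |Real.log (T γ : ℝ)|) ^ 0), ?_, fun γ => mul_nonneg C.2 (mul_nonneg (inv_nonneg.2 (T γ).2) (pow_nonneg (by positivity) _)), ?_⟩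
  · have h := hf.smul (C : ℝ)
    rw [Pi.smul_def] at h
    simpa only [smul_eq_mul] using h
  · intro γ hreg hZ Θ hΘm hΘS Mb hΘb
    have hTγ := hT0 γ hreg
    have hTγ' : ((T γ : ℝ≥0) : ℝ≥0∞) ≠ 0 := by exact_mod_cast hTγ
    have hL := hC Θ hΘm hΘS Mb hΘb γ hreg hZ
    rw [← hT] at hL
    have hI : ∫⁻ x, Θ (x * γ * x⁻¹) ∂μ ≤ (C : ℝ≥0∞) * Mb / (T γ : ℝ≥0∞) :=
      (ENNReal.le_div_iff_mul_le (Or.inl hTγ') (Or.inl ENNReal.coe_ne_top)).2 (by rw [mul_comm]; exact hL)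
    refine hI.trans (le_of_eq ?_)
    beta_reduce
    rw [pow_zero, mul_one, ← NNReal.coe_inv, ← NNReal.coe_mul, ENNReal.ofReal_coe_nnreal, ENNReal.coe_mul, ENNReal.coe_inv hTγ, div_eq_mul_inv,
      mul_right_comm]

/-! ## §2 The ∀-closed adapter: the hosted letter pays «ELL-WEIGHT at the place» -/
set_option maxHeartbeats 800000 in -- long statement (two ∀-closed letters) on the one-place carriers
/-- **ROAD-A PAYER — «HC-14-ell at the place» (cand v2 `sig_K2E3HC14EllRankOnePlace`, ∀-closed: ★ p857125's binder) ⇒ «ELL-WEIGHT at the place» (∀-closed: ★ (M5h‴)'s binder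
`hEW`)**, binder kinds after `hEll` mirroring cand v2 (`(L) [Field] [NumberField] [IsCMField] {v} (w) (hw) [MeasurableSpace] [BorelSpace] (μ) [IsHaarMeasure] {S} (hS)`), so that
`ellWeightPlace_of_hc14EllPlace sig_K2E3HC14EllRankOnePlace` IS `hEW`.  `W_E := C · T⁻¹` (§1). [cite: HarishChandra1970, Part VI §8 Theorem 14 p. 60; Part VII §1 Theorem 15 p. 63] -/
theorem ellWeightPlace_of_hc14EllPlace
    (hEll : ∀ (L' : Type) [Field L'] [NumberField L'] [IsCMField L'] {v' : HeightOneSpectrum (𝓞 ↥(maximalRealSubfield L'))}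
      (w' : UnitaryGroup.PlacesOver L' v') (hw' : IsCMField.complexConj L' • w'.1 = w'.1)
      [MeasurableSpace ↥(unitaryGroupOfForm (galAdicCompletionMap (L := L') (IsCMField.complexConj L') hw') ((StdForm.antidiagonal 3).over (w'.1.adicCompletion L')))]
      [BorelSpace ↥(unitaryGroupOfForm (galAdicCompletionMap (L := L') (IsCMField.complexConj L') hw') ((StdForm.antidiagonal 3).over (w'.1.adicCompletion L')))]
      (μ' : Measure ↥(unitaryGroupOfForm (galAdicCompletionMap (L := L') (IsCMField.complexConj L') hw') ((StdForm.antidiagonal 3).over (w'.1.adicCompletion L')))) [μ'.IsHaarMeasure]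
      {S : Set ↥(unitaryGroupOfForm (galAdicCompletionMap (L := L') (IsCMField.complexConj L') hw') ((StdForm.antidiagonal 3).over (w'.1.adicCompletion L')))} (_ : IsCompact S),
      ∃ C : ℝ≥0, ∀ Θ : ↥(unitaryGroupOfForm (galAdicCompletionMap (L := L') (IsCMField.complexConj L') hw') ((StdForm.antidiagonal 3).over (w'.1.adicCompletion L'))) → ℝ≥0∞,
        Measurable Θ → (∀ g, Θ g ≠ 0 → g ∈ S) → ∀ M : ℝ≥0∞, (∀ g, Θ g ≤ M) →
        ∀ γ : ↥(unitaryGroupOfForm (galAdicCompletionMap (L := L') (IsCMField.complexConj L') hw') ((StdForm.antidiagonal 3).over (w'.1.adicCompletion L'))),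
          IsRegularElt (γ : GL (Fin 3) (w'.1.adicCompletion L')) →
          IsCompact ((Subgroup.centralizer ({γ} : Set ↥(unitaryGroupOfForm (galAdicCompletionMap (L := L') (IsCMField.complexConj L') hw') ((StdForm.antidiagonal 3).over (w'.1.adicCompletion L'))))) :
              Set ↥(unitaryGroupOfForm (galAdicCompletionMap (L := L') (IsCMField.complexConj L') hw') ((StdForm.antidiagonal 3).over (w'.1.adicCompletion L')))) →
            ((NNReal.sqrt (NNReal.sqrt
                (normAbs (w'.1.adicCompletion L') (((γ : GL (Fin 3) (w'.1.adicCompletion L')) : Matrix (Fin 3) (Fin 3) (w'.1.adicCompletion L'))).charpoly.discr *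
                  (normAbs (w'.1.adicCompletion L') (((γ : GL (Fin 3) (w'.1.adicCompletion L')) : Matrix (Fin 3) (Fin 3) (w'.1.adicCompletion L'))).det ^ 2)⁻¹)) :
                ℝ≥0) : ℝ≥0∞) *
              ∫⁻ x, Θ (x * γ * x⁻¹) ∂μ' ≤ C * M)
    (L : Type) [Field L] [NumberField L] [IsCMField L] {v : HeightOneSpectrum (𝓞 ↥(maximalRealSubfield L))}
    (w : UnitaryGroup.PlacesOver L v) (hw : IsCMField.complexConj L • w.1 = w.1)
    [MeasurableSpace ↥(unitaryGroupOfForm (galAdicCompletionMap (L := L) (IsCMField.complexConj L) hw) ((StdForm.antidiagonal 3).over (w.1.adicCompletion L)))]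
    [BorelSpace ↥(unitaryGroupOfForm (galAdicCompletionMap (L := L) (IsCMField.complexConj L) hw) ((StdForm.antidiagonal 3).over (w.1.adicCompletion L)))]
    (μ : Measure ↥(unitaryGroupOfForm (galAdicCompletionMap (L := L) (IsCMField.complexConj L) hw) ((StdForm.antidiagonal 3).over (w.1.adicCompletion L)))) [μ.IsHaarMeasure]
    {S : Set ↥(unitaryGroupOfForm (galAdicCompletionMap (L := L) (IsCMField.complexConj L) hw) ((StdForm.antidiagonal 3).over (w.1.adicCompletion L)))} (hS : IsCompact S) :
    ∃ W_E : ↥(unitaryGroupOfForm (galAdicCompletionMap (L := L) (IsCMField.complexConj L) hw) ((StdForm.antidiagonal 3).over (w.1.adicCompletion L))) → ℝ,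
      LocallyIntegrable W_E μ ∧ (∀ g, 0 ≤ W_E g) ∧
      ∀ γ : ↥(unitaryGroupOfForm (galAdicCompletionMap (L := L) (IsCMField.complexConj L) hw) ((StdForm.antidiagonal 3).over (w.1.adicCompletion L))),
        IsRegularElt (γ : GL (Fin 3) (w.1.adicCompletion L)) →
        IsCompact ((Subgroup.centralizer ({γ} : Set ↥(unitaryGroupOfForm (galAdicCompletionMap (L := L) (IsCMField.complexConj L) hw) ((StdForm.antidiagonal 3).over (w.1.adicCompletion L))))) :
            Set ↥(unitaryGroupOfForm (galAdicCompletionMap (L := L) (IsCMField.complexConj L) hw) ((StdForm.antidiagonal 3).over (w.1.adicCompletion L)))) →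
          ∀ Θ : ↥(unitaryGroupOfForm (galAdicCompletionMap (L := L) (IsCMField.complexConj L) hw) ((StdForm.antidiagonal 3).over (w.1.adicCompletion L))) → ℝ≥0∞,
            Measurable Θ → (∀ g, Θ g ≠ 0 → g ∈ S) → ∀ Mb : ℝ≥0∞, (∀ g, Θ g ≤ Mb) →
              ∫⁻ x, Θ (x * γ * x⁻¹) ∂μ ≤ ENNReal.ofReal (W_E γ) * Mb :=
  ellWeightPlace_of_hc14Ell_at L w hw μ (hEll L w hw μ hS)

end Summit.HodgeConjecture.HodgeConjecture.Cruxes.H413.K2E3EllWeightPlaceOfHC14EllPlace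

end
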